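import Summits.CriticalPhenomena.PercolationContinuityZ3.Theorems.PercNearOneGluingNoHeavyLowerTailPivotalDualRowR2
import Summits.CriticalPhenomena.PercolationContinuityZ3.Theorems.PercNearOneGluingNoHeavyLowerTailPivotalThreeEvents
import Mathlib.Tactic.Linarith
import Mathlib.Tactic.Positivity
import Mathlib.Tactic.Ring
import HarnessLib

/-!
# `NoHeavyLowerTail` (stmt-CriticalPhenomena-4575) — the pivotal refinement, VI: the row dR3
# `T_a · T_b ≤ u_c · T₀` on EVERY finite weighted graph ("given `a ~ b` off `c`, the events `a ~ c` off `b` and `b ~ c` off `a`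
# are positively correlated")

Support file (prover prim-gen-kcluster gen 44; `--supports stmt-CriticalPhenomena-4575`).  No named facts, no sorries, no definitions.

Cells of `PrW D p` (terminals `a b c` pairwise distinct; `H_a := (pivEv a b c)ᶜ = {b ~ c off a}`, `H_b := (pivEv b a c)ᶜ = {a ~ c off b}`,
`H_c := (pivEv c a b)ᶜ = {a ~ b off c}`, three INCREASING events whose eight atoms are the coarse cells, `PivotalBHK.apart_eq` /
`Ua_eq'` / `Ta_eq` / `T0_eq`):  `q = P(a|b|c)` (none), `u_x` (only `H_x`), `T_a = P(abc ∧ a pivotal) = P(H_b H_c ¬H_a)`, …,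
`T₀ = P(H_a H_b H_c)` (all joined, no terminal pivotal).

**THEOREM dR3 (`dualRowR3_PrW`, conjectured in KCLUSTER-gen43 §2, census kit j135998 / j136943).**  `T_a · T_b ≤ u_c · T₀`.
Equivalently: conditionally on `{a ~ b off c}`, the events `{a ~ c off b}` and `{b ~ c off a}` are positively correlated; in the exploded
graph / for disjoint vertex sets `A, B, C`: given `A ~ B`, the events `A ~ C` and `B ~ C` are positively correlated (van den Berg–Häggström–Kahn
prove the NEGATIVE correlation of the same two events given `A ≁ B`).  It is the dual (`t ↔ q`, separating cells ↔ pivotal cells) of the refined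
row R3 `s_a s_b ≤ u_c b₀` (`RefinedRowR3.r3_PrW`).

PROOF (elementary, but a DEGREE-FOUR product certificate — which is why the degree-two LP of KCLUSTER-gen43 (`lp11.py`, constant multipliers of
quadratic rows) reported dR3 outside the cone of the known rows).  Write `α = H_b`, `β = H_a`, `W = H_c`.  Ingredients:
* the BHK rows (`PivotalBHK.bhkRow_PrW`, [cite: VandenbergHaggstromKahn2005, Thm. 1.4 (p. 7)]) at `a` and at `b`:
  `q T_a ≤ u_b u_c` and `q T_b ≤ u_a u_c`, i.e. `P(¬β) P(αW¬β) ≤ P(α¬β) P(W¬β)`, `P(¬α) P(βW¬α) ≤ P(β¬α) P(W¬α)`, and, once more from the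
  row at `b`, `P(W¬α) P(¬α¬β) ≤ P(W¬α¬β) P(¬α)`;
* Harris three times (mixed form `PivotalBHK.PrW_inter_le_of_lower_upper`): `P(α¬β) P(β¬α) ≤ P(αβ) P(¬α¬β)`, `P(W¬β) ≤ P(W) P(¬β)`,
  `P(W) P(αβ) ≤ P(Wαβ)`.
Chain: `P(¬α)P(¬β) · T_a T_b ≤ [P(α¬β)P(W¬β)]·[P(β¬α)P(W¬α)] ≤ P(αβ)P(¬α¬β)·P(W¬β)P(W¬α) ≤ P(αβ)P(¬α¬β)·P(W)P(¬β)·P(W¬α)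
= [P(W)P(αβ)]·[P(¬α¬β)P(W¬α)]·P(¬β) ≤ T₀ · u_c P(¬α) · P(¬β)`; cancel `P(¬α)P(¬β)` (if it vanishes, so does `T_a T_b`).
The real-arithmetic core is `dualRowR3_real`; the event bookkeeping is the three-event dictionary of part IV.
Tight on every blob network (there the three events are independent and every step is an equality).
-/

noncomputable section

namespace Summit.CriticalPhenomena.PercolationContinuityZ3.Theorems

namespace PivotalBHK

open Finset MeasureTheory Literature.Probability.Percolation Literature.Probability.Percolation.DecisionTree
open Gladkov ThreePointGamma CovTauStarN ThreePointLB
open scoped Classical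

variable {V : Type*} [Fintype V] [DecidableEq V]

/-! ### The real-arithmetic core: a degree-four chain -/

section Real

omit [Fintype V] [DecidableEq V] in
/-- **The chain behind dR3.**  Nonnegative reals `q, u_a, u_b, u_c, T_a, T_b, T₀` together with `Z = P(αβ)`, `w = P(W)`,
`nα = P(¬α) = q + u_a + u_c + T_b`, `nβ = P(¬β) = q + u_b + u_c + T_a` satisfying the two BHK rows and the three Harris
inequalities of the file header obey `T_a T_b ≤ u_c T₀`. [this work] -/
theorem dualRowR3_real {q ua ub uc Ta Tb T0 Z w nα nβ : ℝ}
    (hq : 0 ≤ q) (hua : 0 ≤ ua) (hub : 0 ≤ ub) (huc : 0 ≤ uc) (hTa : 0 ≤ Ta) (hTb : 0 ≤ Tb) (hT0 : 0 ≤ T0)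
    (hZ : 0 ≤ Z)
    (hrowa : q * Ta ≤ ub * uc) (hrowb : q * Tb ≤ ua * uc)
    (hnβ : nβ = q + ub + uc + Ta) (hnα : nα = q + ua + uc + Tb)
    (hH1 : (ub + Ta) * (ua + Tb) ≤ Z * (q + uc)) (hH2 : uc + Ta ≤ w * nβ) (hH3 : w * Z ≤ T0) :
    Ta * Tb ≤ uc * T0 := by
  have hnβ0 : 0 ≤ nβ := by rw [hnβ]; positivity
  have hnα0 : 0 ≤ nα := by rw [hnα]; positivity
  -- the BHK rows in conditional form
  have r1 : nβ * Ta ≤ (ub + Ta) * (uc + Ta) := by rw [hnβ]; nlinarith [hrowa]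
  have r2 : nα * Tb ≤ (ua + Tb) * (uc + Tb) := by rw [hnα]; nlinarith [hrowb]
  have r3 : (uc + Tb) * (q + uc) ≤ uc * nα := by rw [hnα]; nlinarith [hrowb]
  -- the chain
  have c1 : (nβ * Ta) * (nα * Tb) ≤ ((ub + Ta) * (uc + Ta)) * ((ua + Tb) * (uc + Tb)) :=
    mul_le_mul r1 r2 (by positivity) (by positivity)
  have c2 : ((ub + Ta) * (ua + Tb)) * ((uc + Ta) * (uc + Tb)) ≤ (Z * (q + uc)) * ((uc + Ta) * (uc + Tb)) :=
    mul_le_mul_of_nonneg_right hH1 (by positivity)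
  have c3 : (Z * (q + uc)) * ((uc + Ta) * (uc + Tb)) ≤ (Z * (q + uc)) * ((w * nβ) * (uc + Tb)) :=
    mul_le_mul_of_nonneg_left (mul_le_mul_of_nonneg_right hH2 (by positivity)) (by positivity)
  have c4 : (w * Z) * ((uc + Tb) * (q + uc)) ≤ T0 * (uc * nα) :=
    mul_le_mul hH3 r3 (by positivity) hT0
  have c5 : (w * Z) * ((uc + Tb) * (q + uc)) * nβ ≤ T0 * (uc * nα) * nβ := mul_le_mul_of_nonneg_right c4 hnβ0
  have key : (nα * nβ) * (Ta * Tb) ≤ (nα * nβ) * (uc * T0) := by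
    have e1 : (nβ * Ta) * (nα * Tb) = (nα * nβ) * (Ta * Tb) := by ring
    have e2 : ((ub + Ta) * (uc + Ta)) * ((ua + Tb) * (uc + Tb)) = ((ub + Ta) * (ua + Tb)) * ((uc + Ta) * (uc + Tb)) := by ring
    have e3 : (Z * (q + uc)) * ((w * nβ) * (uc + Tb)) = (w * Z) * ((uc + Tb) * (q + uc)) * nβ := by ring
    have e4 : T0 * (uc * nα) * nβ = (nα * nβ) * (uc * T0) := by ring
    rw [← e1, ← e4]
    calc (nβ * Ta) * (nα * Tb) ≤ ((ub + Ta) * (uc + Ta)) * ((ua + Tb) * (uc + Tb)) := c1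
      _ = ((ub + Ta) * (ua + Tb)) * ((uc + Ta) * (uc + Tb)) := e2
      _ ≤ (Z * (q + uc)) * ((uc + Ta) * (uc + Tb)) := c2
      _ ≤ (Z * (q + uc)) * ((w * nβ) * (uc + Tb)) := c3
      _ = (w * Z) * ((uc + Tb) * (q + uc)) * nβ := e3
      _ ≤ T0 * (uc * nα) * nβ := c5
  by_cases h0 : nα * nβ = 0
  · -- then `nα = 0` (so `T_b = 0`) or `nβ = 0` (so `T_a = 0`)
    rcases mul_eq_zero.1 h0 with h | h
    · have hTb0 : Tb = 0 := by rw [hnα] at h; linarith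
      rw [hTb0, mul_zero]; positivity
    · have hTa0 : Ta = 0 := by rw [hnβ] at h; linarith
      rw [hTa0, zero_mul]; positivity
  · have hpos : 0 < nα * nβ := lt_of_le_of_ne (by positivity) (Ne.symm h0)
    exact le_of_mul_le_mul_left key hpos

end Real

/-! ### Small set lemmas -/

section Sets

variable {a b c : V}

/-- `pivEv c a b = pivEv c b a`: "`a ≁ b` off `c`" is symmetric in `a, b`. [this work] -/
theorem pivEv_comm (c a b : V) : (pivEv c a b : Set (Finset (Sym2 V))) = pivEv c b a := by
  ext K
  simp only [mem_pivEv]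
  exact not_congr mem_cl_comm

omit [Fintype V] [DecidableEq V] in
/-- Splitting an event by a second one: `PrW X = PrW (X ∩ Y) + PrW (X ∩ Yᶜ)`. [folklore] -/
theorem PrW_eq_inter_add_inter_compl {ι : Type*} [DecidableEq ι] (D : Finset ι) (p : ι → ℝ) (X Y : Set (Finset ι)) :
    PrW D p X = PrW D p (X ∩ Y) + PrW D p (X ∩ Yᶜ) := by
  rw [← PrW_union D p (Set.disjoint_left.2 fun K h1 h2 => h2.2 h1.2), Set.inter_union_compl]

end Sets

/-! ### THEOREM dR3 -/

section Main

variable (D : Finset (Sym2 V)) {p : Sym2 V → ℝ} (hp0 : ∀ e, 0 ≤ p e) (hp1 : ∀ e, p e ≤ 1) {a b c : V}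
include hp0 hp1

/-- **THEOREM dR3, three-event form.**  With `Pa = pivEv a b c = ¬H_a`, `Pb = ¬H_b`, `Pc = ¬H_c` (pairwise distinct terminals):
`P(Pa ∩ Pbᶜ ∩ Pcᶜ) · P(Paᶜ ∩ Pb ∩ Pcᶜ) ≤ P(Pa ∩ Pb ∩ Pcᶜ) · P(Paᶜ ∩ Pbᶜ ∩ Pcᶜ)`, i.e. `T_a T_b ≤ u_c T₀`:
given `H_c = {a ~ b off c}`, the events `H_b = {a ~ c off b}` and `H_a = {b ~ c off a}` are positively correlated. [this work] -/
theorem dualRowR3_H (hab : a ≠ b) (hac : a ≠ c) (hbc : b ≠ c) :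
    PrW D p (pivEv a b c ∩ (pivEv b a c)ᶜ ∩ (pivEv c a b)ᶜ) * PrW D p ((pivEv a b c)ᶜ ∩ pivEv b a c ∩ (pivEv c a b)ᶜ) ≤
      PrW D p (pivEv a b c ∩ pivEv b a c ∩ (pivEv c a b)ᶜ) * PrW D p ((pivEv a b c)ᶜ ∩ (pivEv b a c)ᶜ ∩ (pivEv c a b)ᶜ) := by
  have hba : b ≠ a := fun h => hab h.symm
  have hca : c ≠ a := fun h => hac h.symm
  have hcb : c ≠ b := fun h => hbc h.symm
  -- the BHK rows at `a` and at `b`, translated into the atoms of the three events by the dictionary of part IV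
  have Dq : ((conn a b)ᶜ ∩ (conn a c)ᶜ ∩ (conn b c)ᶜ : Set (Finset (Sym2 V))) = pivEv a b c ∩ pivEv b a c ∩ pivEv c a b :=
    apart_eq hab hac hbc
  have DTa : (conn a b ∩ conn a c ∩ pivEv a b c : Set (Finset (Sym2 V))) = pivEv a b c ∩ (pivEv b a c)ᶜ ∩ (pivEv c a b)ᶜ := by
    rw [Ta_eq hab hac hbc]
    ext K; simp only [Set.mem_inter_iff, Set.mem_compl_iff]; tauto
  have DTb : (conn b a ∩ conn b c ∩ pivEv b a c : Set (Finset (Sym2 V))) = (pivEv a b c)ᶜ ∩ pivEv b a c ∩ (pivEv c a b)ᶜ := by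
    rw [Ta_eq hba hbc hac, pivEv_comm c b a]
    ext K; simp only [Set.mem_inter_iff, Set.mem_compl_iff]; tauto
  have Dua : (conn b c ∩ (conn a b)ᶜ : Set (Finset (Sym2 V))) = (pivEv a b c)ᶜ ∩ pivEv b a c ∩ pivEv c a b := Ua_eq' hab hac hbc
  have Dub : (conn a c ∩ (conn a b)ᶜ : Set (Finset (Sym2 V))) = pivEv a b c ∩ (pivEv b a c)ᶜ ∩ pivEv c a b := by
    have h := Ua_eq' hba hbc hac
    rw [conn_comm b a, pivEv_comm c b a] at h
    rw [h]
    ext K; simp only [Set.mem_inter_iff, Set.mem_compl_iff]; tauto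
  have Duc : (conn a b ∩ (conn a c)ᶜ : Set (Finset (Sym2 V))) = pivEv a b c ∩ pivEv b a c ∩ (pivEv c a b)ᶜ := by
    have h := Ua_eq' hca hcb hab
    rw [conn_comm c a, pivEv_comm a c b, pivEv_comm b c a] at h
    rw [h]
    ext K; simp only [Set.mem_inter_iff, Set.mem_compl_iff]; tauto
  have hA := bhkRow_PrW hp0 hp1 D hab hac
  rw [Dq, DTa, Dub, Duc] at hA
  have hB := bhkRow_PrW hp0 hp1 D (a := b) (b := a) (c := c) hba hbc
  have sQb : ((conn b a)ᶜ ∩ (conn b c)ᶜ ∩ (conn a c)ᶜ : Set (Finset (Sym2 V))) = (conn a b)ᶜ ∩ (conn a c)ᶜ ∩ (conn b c)ᶜ := by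
    rw [conn_comm b a]; ext K; simp only [Set.mem_inter_iff, Set.mem_compl_iff]; tauto
  have sUa : (conn b c ∩ (conn b a)ᶜ : Set (Finset (Sym2 V))) = conn b c ∩ (conn a b)ᶜ := by rw [conn_comm b a]
  have sUc : (conn b a ∩ (conn b c)ᶜ : Set (Finset (Sym2 V))) = conn a b ∩ (conn a c)ᶜ := by
    rw [conn_comm b a]
    ext K
    simp only [Set.mem_inter_iff, Set.mem_compl_iff]
    constructor
    · rintro ⟨hab', hbc'⟩; exact ⟨hab', fun hac' => hbc' (mem_conn.2 ((mem_conn.1 hab').symm.trans (mem_conn.1 hac')))⟩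
    · rintro ⟨hab', hac'⟩; exact ⟨hab', fun hbc' => hac' (mem_conn.2 ((mem_conn.1 hab').trans (mem_conn.1 hbc')))⟩
  rw [sQb, sUa, sUc, Dq, DTb, Dua, Duc] at hB
  -- the three decreasing events and their eight atoms (canonical order `Pa^± ∩ Pb^± ∩ Pc^±`)
  set Pa : Set (Finset (Sym2 V)) := pivEv a b c with hPa
  set Pb : Set (Finset (Sym2 V)) := pivEv b a c with hPb
  set Pc : Set (Finset (Sym2 V)) := pivEv c a b with hPc
  have lPa : IsLowerSet Pa := isLowerSet_pivEv a b c
  have lPb : IsLowerSet Pb := isLowerSet_pivEv b a c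
  have lPc : IsLowerSet Pc := isLowerSet_pivEv c a b
  set q := PrW D p (Pa ∩ Pb ∩ Pc) with hq
  set ua := PrW D p (Paᶜ ∩ Pb ∩ Pc) with hua
  set ub := PrW D p (Pa ∩ Pbᶜ ∩ Pc) with hub
  set uc := PrW D p (Pa ∩ Pb ∩ Pcᶜ) with huc
  set Ta := PrW D p (Pa ∩ Pbᶜ ∩ Pcᶜ) with hTa
  set Tb := PrW D p (Paᶜ ∩ Pb ∩ Pcᶜ) with hTb
  set T0 := PrW D p (Paᶜ ∩ Pbᶜ ∩ Pcᶜ) with hT0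
  have nn := fun X => PrW_nonneg D hp0 hp1 (p := p) X
  -- splitting identities
  have sp := PrW_eq_inter_add_inter_compl D p
  have S8 : PrW D p (Pa ∩ Pb) = q + uc := sp (Pa ∩ Pb) Pc
  have S2 : PrW D p (Pa ∩ Pbᶜ) = ub + Ta := sp (Pa ∩ Pbᶜ) Pc
  have S1 : PrW D p Pa = q + ub + uc + Ta := by rw [sp Pa Pb, S8, S2]; ring
  have S3 : PrW D p (Pa ∩ Pcᶜ) = uc + Ta := by
    rw [sp (Pa ∩ Pcᶜ) Pb]
    have e1 : Pa ∩ Pcᶜ ∩ Pb = Pa ∩ Pb ∩ Pcᶜ := by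
      ext K; simp only [Set.mem_inter_iff, Set.mem_compl_iff]; tauto
    have e2 : Pa ∩ Pcᶜ ∩ Pbᶜ = Pa ∩ Pbᶜ ∩ Pcᶜ := by
      ext K; simp only [Set.mem_inter_iff, Set.mem_compl_iff]; tauto
    rw [e1, e2]
  have S5 : PrW D p (Paᶜ ∩ Pb) = ua + Tb := sp (Paᶜ ∩ Pb) Pc
  have S4 : PrW D p Pb = q + ua + uc + Tb := by
    rw [sp Pb Pa, Set.inter_comm Pb Pa, S8, Set.inter_comm Pb Paᶜ, S5]; ring
  have S10 : PrW D p Pbᶜ = ub + Ta + PrW D p (Paᶜ ∩ Pbᶜ) := by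
    rw [sp Pbᶜ Pa, Set.inter_comm Pbᶜ Pa, Set.inter_comm Pbᶜ Paᶜ, S2]
  have S11 : PrW D p Paᶜ = ua + Tb + PrW D p (Paᶜ ∩ Pbᶜ) := by
    rw [sp Paᶜ Pb, S5]
  have Stot : PrW D p Pa + PrW D p Paᶜ = 1 := by
    rw [← PrW_union D p disjoint_compl_right, Set.union_compl_self, PrW_univ]
  have S9 : PrW D p (Pcᶜ ∩ (Paᶜ ∩ Pbᶜ)ᶜ) = PrW D p Pcᶜ - T0 := by
    have h := sp Pcᶜ (Paᶜ ∩ Pbᶜ)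
    have e1 : Pcᶜ ∩ (Paᶜ ∩ Pbᶜ) = Paᶜ ∩ Pbᶜ ∩ Pcᶜ := by
      ext K; simp only [Set.mem_inter_iff, Set.mem_compl_iff]; tauto
    rw [e1] at h
    rw [hT0, h]; ring
  have S12 : PrW D p (Paᶜ ∩ Pbᶜ)ᶜ = 1 - PrW D p (Paᶜ ∩ Pbᶜ) := by
    have h := sp Set.univ (Paᶜ ∩ Pbᶜ)
    rw [Set.univ_inter, Set.univ_inter, PrW_univ] at h
    linarith
  -- Harris (1): `α = Pbᶜ`, `β = Paᶜ` positively correlated, `P(α¬β) P(β¬α) ≤ P(αβ) P(¬α¬β)`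
  have H1 : (ub + Ta) * (ua + Tb) ≤ PrW D p (Paᶜ ∩ Pbᶜ) * (q + uc) := by
    have h := PrW_inter_le_of_lower_upper D hp0 hp1 lPa lPb.compl
    rw [S2, S10, S1] at h
    have hy : ua + Tb = 1 - (q + ub + uc + Ta) - PrW D p (Paᶜ ∩ Pbᶜ) := by linarith [Stot, S11, S1]
    have e : (ub + Ta) * (1 - (q + ub + uc + Ta) - PrW D p (Paᶜ ∩ Pbᶜ)) = PrW D p (Paᶜ ∩ Pbᶜ) * (q + uc) +
        ((ub + Ta) - (q + ub + uc + Ta) * (ub + Ta + PrW D p (Paᶜ ∩ Pbᶜ))) := by ring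
    rw [hy, e]
    linarith [h]
  -- Harris (2): `P(W¬β) ≤ P(W) P(¬β)`
  have H2 : uc + Ta ≤ PrW D p Pcᶜ * PrW D p Pa := by
    have h := PrW_inter_le_of_lower_upper D hp0 hp1 lPa lPc.compl
    rw [S3] at h
    linarith [h, mul_comm (PrW D p Pa) (PrW D p Pcᶜ)]
  -- Harris (3): `P(W) P(αβ) ≤ P(Wαβ)`
  have H3 : PrW D p Pcᶜ * PrW D p (Paᶜ ∩ Pbᶜ) ≤ T0 := by
    have hl : IsLowerSet (Paᶜ ∩ Pbᶜ)ᶜ := (lPa.compl.inter lPb.compl).compl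
    have h := PrW_inter_le_of_lower_upper D hp0 hp1 hl lPc.compl
    rw [Set.inter_comm (Paᶜ ∩ Pbᶜ)ᶜ Pcᶜ, S9, S12] at h
    have e : (1 - PrW D p (Paᶜ ∩ Pbᶜ)) * PrW D p Pcᶜ = PrW D p Pcᶜ - PrW D p Pcᶜ * PrW D p (Paᶜ ∩ Pbᶜ) := by ring
    rw [e] at h
    linarith [h]
  -- conclude with the real-arithmetic chain
  exact dualRowR3_real (nn _) (nn _) (nn _) (nn _) (nn _) (nn _) (nn _) (nn _) hA hB S1 S4 H1 H2 H3

/-- **THEOREM dR3 (dual of the refined row R3), cell form.**  On the coordinates `D` with weights `p ∈ [0,1]`, for pairwise distinct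
`a, b, c`:  `T_a · T_b ≤ u_c · T₀`, where `T_x = P(all joined ∧ x pivotal)`, `u_c = P(ab|c)` and `T₀ = P(all joined, no terminal pivotal)`.
BHK rows at `a`, `b` + Harris (degree-four chain, `dualRowR3_real`). [this work] -/
theorem dualRowR3_PrW (hab : a ≠ b) (hac : a ≠ c) (hbc : b ≠ c) :
    PrW D p (conn a b ∩ conn a c ∩ pivEv a b c) * PrW D p (conn b a ∩ conn b c ∩ pivEv b a c) ≤
      PrW D p (conn a b ∩ (conn a c)ᶜ) *
        PrW D p (conn a b ∩ conn a c ∩ ((pivEv a b c)ᶜ ∩ (pivEv b a c)ᶜ ∩ (pivEv c a b)ᶜ)) := by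
  have hba : b ≠ a := fun h => hab h.symm
  have hca : c ≠ a := fun h => hac h.symm
  have hcb : c ≠ b := fun h => hbc h.symm
  have DTa : (conn a b ∩ conn a c ∩ pivEv a b c : Set (Finset (Sym2 V))) = pivEv a b c ∩ (pivEv b a c)ᶜ ∩ (pivEv c a b)ᶜ := by
    rw [Ta_eq hab hac hbc]
    ext K; simp only [Set.mem_inter_iff, Set.mem_compl_iff]; tauto
  have DTb : (conn b a ∩ conn b c ∩ pivEv b a c : Set (Finset (Sym2 V))) = (pivEv a b c)ᶜ ∩ pivEv b a c ∩ (pivEv c a b)ᶜ := by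
    rw [Ta_eq hba hbc hac, pivEv_comm c b a]
    ext K; simp only [Set.mem_inter_iff, Set.mem_compl_iff]; tauto
  have Duc : (conn a b ∩ (conn a c)ᶜ : Set (Finset (Sym2 V))) = pivEv a b c ∩ pivEv b a c ∩ (pivEv c a b)ᶜ := by
    have h := Ua_eq' hca hcb hab
    rw [conn_comm c a, pivEv_comm a c b, pivEv_comm b c a] at h
    rw [h]
    ext K; simp only [Set.mem_inter_iff, Set.mem_compl_iff]; tauto
  rw [DTa, DTb, Duc, T0_eq]
  exact dualRowR3_H D hp0 hp1 hab hac hbc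

end Main

end PivotalBHK

end Summit.CriticalPhenomena.PercolationContinuityZ3.Theorems

end
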